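import Summits.Ventures.CertifiedManyBodySolver.Certificates.HubbardSquare_transportClosure_Kit
import HarnessLib

/-!
# Ventures/CertifiedManyBodySolver — Certificates/HubbardSquare_transportClosure_KitPh.lean
# (hubbard-fast-reuse-5 g2, cell hubbard-fast, D-0154 (A) CERTIFICATE REUSE: the TRANSPORT-CLOSURE kit, part 4 = the EXACT particle–hole
# image of a whole multilinear word; parts 1–3 = `…_Kit.lean`, `…_KitLaws.lean` (reuse-1), `…_KitT.lean` (reuse-5))

The particle–hole map of the square-lattice `t–t'–U` Hubbard model, `e(t,s,U,n) = e(t,-s,U,2-n) + U(n-1)`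
(`energyDensityTT'_particleHole`), is affine in each coordinate separately, so the image of an 8-coefficient (coordinatewise-affine)
word on a HOLE-side box `[a₀,b₀]×[a₁,b₁]×[a₂,b₂]` (`0 < a₂`, `b₂ < 2`, `a₀ ≥ 0`) is again an 8-coefficient word, now on the IMAGE box
`[a₀,b₀]×[-b₁,-a₁]×[2-b₂,2-a₂]`, with literally transformed coefficients (`tc_mlword_phImage`): floor and cap
`P(θ0,-θ1,2-θ2) + θ0(θ2-1)`, i.e. `[c₀+2c₃, c₁+2c₅-1, -c₂-2c₆, -c₃, -c₄-2c₇, 1-c₅, c₆, c₇]` on `[1, θ0, θ1, θ2, θ0θ1, θ0θ2, θ1θ2, θ0θ1θ2]`.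
After this step every kit law (U-, n-, t'-line) applies to image words exactly as to direct ones (no slice-and-carry loss).
HONEST FRAMING: a bookkeeping adapter; certifies nothing by itself; a consumer inherits exactly the hypotheses of the word it cites;
no number of record; not a phase word; no summit statement is proved here; not a superconductivity verdict.
-/

namespace Summit.Ventures.CertifiedManyBodySolver.Certificates

open Literature.MathematicalPhysics.QuantumLattice
open Literature.MathematicalPhysics.QuantumLattice.ThermodynamicLimit
open Set

/-- **Exact particle–hole image of a multilinear word.** A word on the hole-side box `[a₀,b₀]×[a₁,b₁]×[a₂,b₂]` (`0 ≤ a₀`, `0 < a₂`,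
`b₂ < 2`) is, read through `e(t,s,U,n) = e(t,-s,U,2-n) + U(n-1)`, a word on the image box `[a₀,b₀]×[-b₁,-a₁]×[2-b₂,2-a₂]` with the
coefficients `[c₀+2c₃, c₁+2c₅-1, -c₂-2c₆, -c₃, -c₄-2c₇, 1-c₅, c₆, c₇]` (floor) and the same transform of `d` (cap).
[cite: LiebWuPhysicaA2003, §1 eq. (3)] -/
theorem tc_mlword_phImage (t : ℝ) {a₀ a₁ a₂ b₀ b₁ b₂ : ℝ}
    {c₀ c₁ c₂ c₃ c₄ c₅ c₆ c₇ d₀ d₁ d₂ d₃ d₄ d₅ d₆ d₇ : ℝ}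
    (h : ∀ θ ∈ Set.Icc (![a₀, a₁, a₂] : Fin 3 → ℝ) ![b₀, b₁, b₂],
      c₀ + c₁ * θ 0 + c₂ * θ 1 + c₃ * θ 2 + c₄ * θ 0 * θ 1 + c₅ * θ 0 * θ 2 + c₆ * θ 1 * θ 2 +
          c₇ * θ 0 * θ 1 * θ 2 ≤ energyDensityTT' t (θ 1) (θ 0) (θ 2) ∧
        energyDensityTT' t (θ 1) (θ 0) (θ 2) ≤ d₀ + d₁ * θ 0 + d₂ * θ 1 + d₃ * θ 2 + d₄ * θ 0 * θ 1 +
          d₅ * θ 0 * θ 2 + d₆ * θ 1 * θ 2 + d₇ * θ 0 * θ 1 * θ 2)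
    (ha₀ : 0 ≤ a₀) (ha₂ : 0 < a₂) (hb₂ : b₂ < 2) :
    ∀ θ ∈ Set.Icc (![a₀, -b₁, 2 - b₂] : Fin 3 → ℝ) ![b₀, -a₁, 2 - a₂],
      (c₀ + 2 * c₃) + (c₁ + 2 * c₅ - 1) * θ 0 + (-c₂ - 2 * c₆) * θ 1 + (-c₃) * θ 2 + (-c₄ - 2 * c₇) * θ 0 * θ 1 +
          (1 - c₅) * θ 0 * θ 2 + c₆ * θ 1 * θ 2 + c₇ * θ 0 * θ 1 * θ 2 ≤ energyDensityTT' t (θ 1) (θ 0) (θ 2) ∧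
        energyDensityTT' t (θ 1) (θ 0) (θ 2) ≤ (d₀ + 2 * d₃) + (d₁ + 2 * d₅ - 1) * θ 0 + (-d₂ - 2 * d₆) * θ 1 +
          (-d₃) * θ 2 + (-d₄ - 2 * d₇) * θ 0 * θ 1 + (1 - d₅) * θ 0 * θ 2 + d₆ * θ 1 * θ 2 +
          d₇ * θ 0 * θ 1 * θ 2 := by
  intro θ hθ
  obtain ⟨⟨k1, k2⟩, ⟨k3, k4⟩, ⟨k5, k6⟩⟩ := mem_Icc_vec3_iff.1 hθ
  have h₁ := h ![θ 0, -θ 1, 2 - θ 2] (mem_Icc_vec3_iff.2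
    ⟨⟨k1, k2⟩, ⟨show a₁ ≤ -θ 1 by linarith, show -θ 1 ≤ b₁ by linarith⟩,
      ⟨show a₂ ≤ 2 - θ 2 by linarith, show 2 - θ 2 ≤ b₂ by linarith⟩⟩)
  simp only [Matrix.cons_val_zero, Matrix.cons_val_one, Matrix.cons_val] at h₁
  have hph := energyDensityTT'_particleHole t (θ 1) (ha₀.trans k1) (n := θ 2) (by linarith) (by linarith)
  rw [hph]
  constructor
  · linear_combination h₁.1
  · linear_combination h₁.2

end Summit.Ventures.CertifiedManyBodySolver.Certificates
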